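import Mathlib.Algebra.BigOperators.Fin
import Mathlib.Tactic.Ring
import Mathlib.Tactic.Push
import HarnessLib

/-!
# Route `SymPencil` — the BoxFour equality case, 0: the profile arithmetic
# (`--supports` stmt-ValiantsHypothesis-5674 `SdcSuperquadratic`; rung `sdc(per_4) ≥ 21`)

The count behind `AlperBogartVelascoBoxFour.finrank_le_eight_of_subperm_three_vanish` bounds four
numbers `n_p ≤ 4` (the row profile of the filtration) subject to the key-step constraint
"`n_r ≥ 1` and `n_p ≥ 3` force `n_q ≤ 1`" by `Σ n_p ≤ 8`.  In the EQUALITY case `Σ n_p = 8` the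
profile is `(2,2,2,2)` or vanishes outside two positions (which then carry `4, 4`):
`profile_cases`.  Used by `SymPencilBoxFourFiltration.filtration_dichotomy`. [folklore]
-/

-- single-conjunct layout: Sub = Summit, duplicated namespace component intended
set_option linter.dupNamespace false

namespace Summit.ValiantsHypothesis.ValiantsHypothesis.Theorems.SymPencilBoxFourProfile

open Finset

/-- The arithmetic of the equality case: four numbers `≤ 4` summing to `8` and satisfying the
key-step constraint are all equal to `2`, or vanish outside two positions. [folklore] -/
theorem profile_cases (n : Fin 4 → ℕ) (hle : ∀ i, n i ≤ 4) (hsum : ∑ i, n i = 8)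
    (hPL : ∀ p q r, p ≠ q → p ≠ r → q ≠ r → 1 ≤ n r → 3 ≤ n p → n q ≤ 1) :
    (∀ i, n i = 2) ∨ ∃ p q : Fin 4, p ≠ q ∧ ∀ i, i ≠ p → i ≠ q → n i = 0 := by
  have hcases : ∀ i : Fin 4, i = 0 ∨ i = 1 ∨ i = 2 ∨ i = 3 := by decide
  rw [Fin.sum_univ_four] at hsum
  have h0 := hle 0; have h1 := hle 1; have h2 := hle 2; have h3 := hle 3
  by_cases hbig : ∃ p, 3 ≤ n p
  · obtain ⟨p, hp⟩ := hbig
    right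
    rcases hcases p with rfl | rfl | rfl | rfl
    · -- `3 ≤ n 0`
      have c0 : 1 ≤ n 2 → n 1 ≤ 1 := fun h => hPL 0 1 2 (by decide) (by decide)
          (by decide) h hp
      have c1 : 1 ≤ n 1 → n 2 ≤ 1 := fun h => hPL 0 2 1 (by decide) (by decide)
          (by decide) h hp
      have c2 : 1 ≤ n 3 → n 1 ≤ 1 := fun h => hPL 0 1 3 (by decide) (by decide)
          (by decide) h hp
      have c3 : 1 ≤ n 1 → n 3 ≤ 1 := fun h => hPL 0 3 1 (by decide) (by decide)
          (by decide) h hp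
      have c4 : 1 ≤ n 3 → n 2 ≤ 1 := fun h => hPL 0 2 3 (by decide) (by decide)
          (by decide) h hp
      have c5 : 1 ≤ n 2 → n 3 ≤ 1 := fun h => hPL 0 3 2 (by decide) (by decide)
          (by decide) h hp
      by_cases k1 : 1 ≤ n 1
      · refine ⟨0, 1, by decide, fun i hi hi' => ?_⟩
        have hz : n 2 = 0 ∧ n 3 = 0 := by omega
        rcases hcases i with rfl | rfl | rfl | rfl <;>
          first | exact absurd rfl hi | exact absurd rfl hi' | exact hz.1 | exact hz.2
      by_cases k2 : 1 ≤ n 2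
      · refine ⟨0, 2, by decide, fun i hi hi' => ?_⟩
        have hz : n 1 = 0 ∧ n 3 = 0 := by omega
        rcases hcases i with rfl | rfl | rfl | rfl <;>
          first | exact absurd rfl hi | exact absurd rfl hi' | exact hz.1 | exact hz.2
      refine ⟨0, 3, by decide, fun i hi hi' => ?_⟩
      have hz : n 1 = 0 ∧ n 2 = 0 := by omega
      rcases hcases i with rfl | rfl | rfl | rfl <;>
          first | exact absurd rfl hi | exact absurd rfl hi' | exact hz.1 | exact hz.2
    · -- `3 ≤ n 1`
      have c0 : 1 ≤ n 2 → n 0 ≤ 1 := fun h => hPL 1 0 2 (by decide) (by decide)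
          (by decide) h hp
      have c1 : 1 ≤ n 0 → n 2 ≤ 1 := fun h => hPL 1 2 0 (by decide) (by decide)
          (by decide) h hp
      have c2 : 1 ≤ n 3 → n 0 ≤ 1 := fun h => hPL 1 0 3 (by decide) (by decide)
          (by decide) h hp
      have c3 : 1 ≤ n 0 → n 3 ≤ 1 := fun h => hPL 1 3 0 (by decide) (by decide)
          (by decide) h hp
      have c4 : 1 ≤ n 3 → n 2 ≤ 1 := fun h => hPL 1 2 3 (by decide) (by decide)
          (by decide) h hp
      have c5 : 1 ≤ n 2 → n 3 ≤ 1 := fun h => hPL 1 3 2 (by decide) (by decide)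
          (by decide) h hp
      by_cases k1 : 1 ≤ n 0
      · refine ⟨1, 0, by decide, fun i hi hi' => ?_⟩
        have hz : n 2 = 0 ∧ n 3 = 0 := by omega
        rcases hcases i with rfl | rfl | rfl | rfl <;>
          first | exact absurd rfl hi | exact absurd rfl hi' | exact hz.1 | exact hz.2
      by_cases k2 : 1 ≤ n 2
      · refine ⟨1, 2, by decide, fun i hi hi' => ?_⟩
        have hz : n 0 = 0 ∧ n 3 = 0 := by omega
        rcases hcases i with rfl | rfl | rfl | rfl <;>
          first | exact absurd rfl hi | exact absurd rfl hi' | exact hz.1 | exact hz.2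
      refine ⟨1, 3, by decide, fun i hi hi' => ?_⟩
      have hz : n 0 = 0 ∧ n 2 = 0 := by omega
      rcases hcases i with rfl | rfl | rfl | rfl <;>
          first | exact absurd rfl hi | exact absurd rfl hi' | exact hz.1 | exact hz.2
    · -- `3 ≤ n 2`
      have c0 : 1 ≤ n 1 → n 0 ≤ 1 := fun h => hPL 2 0 1 (by decide) (by decide)
          (by decide) h hp
      have c1 : 1 ≤ n 0 → n 1 ≤ 1 := fun h => hPL 2 1 0 (by decide) (by decide)
          (by decide) h hp
      have c2 : 1 ≤ n 3 → n 0 ≤ 1 := fun h => hPL 2 0 3 (by decide) (by decide)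
          (by decide) h hp
      have c3 : 1 ≤ n 0 → n 3 ≤ 1 := fun h => hPL 2 3 0 (by decide) (by decide)
          (by decide) h hp
      have c4 : 1 ≤ n 3 → n 1 ≤ 1 := fun h => hPL 2 1 3 (by decide) (by decide)
          (by decide) h hp
      have c5 : 1 ≤ n 1 → n 3 ≤ 1 := fun h => hPL 2 3 1 (by decide) (by decide)
          (by decide) h hp
      by_cases k1 : 1 ≤ n 0
      · refine ⟨2, 0, by decide, fun i hi hi' => ?_⟩
        have hz : n 1 = 0 ∧ n 3 = 0 := by omega
        rcases hcases i with rfl | rfl | rfl | rfl <;>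
          first | exact absurd rfl hi | exact absurd rfl hi' | exact hz.1 | exact hz.2
      by_cases k2 : 1 ≤ n 1
      · refine ⟨2, 1, by decide, fun i hi hi' => ?_⟩
        have hz : n 0 = 0 ∧ n 3 = 0 := by omega
        rcases hcases i with rfl | rfl | rfl | rfl <;>
          first | exact absurd rfl hi | exact absurd rfl hi' | exact hz.1 | exact hz.2
      refine ⟨2, 3, by decide, fun i hi hi' => ?_⟩
      have hz : n 0 = 0 ∧ n 1 = 0 := by omega
      rcases hcases i with rfl | rfl | rfl | rfl <;>
          first | exact absurd rfl hi | exact absurd rfl hi' | exact hz.1 | exact hz.2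
    · -- `3 ≤ n 3`
      have c0 : 1 ≤ n 1 → n 0 ≤ 1 := fun h => hPL 3 0 1 (by decide) (by decide)
          (by decide) h hp
      have c1 : 1 ≤ n 0 → n 1 ≤ 1 := fun h => hPL 3 1 0 (by decide) (by decide)
          (by decide) h hp
      have c2 : 1 ≤ n 2 → n 0 ≤ 1 := fun h => hPL 3 0 2 (by decide) (by decide)
          (by decide) h hp
      have c3 : 1 ≤ n 0 → n 2 ≤ 1 := fun h => hPL 3 2 0 (by decide) (by decide)
          (by decide) h hp
      have c4 : 1 ≤ n 2 → n 1 ≤ 1 := fun h => hPL 3 1 2 (by decide) (by decide)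
          (by decide) h hp
      have c5 : 1 ≤ n 1 → n 2 ≤ 1 := fun h => hPL 3 2 1 (by decide) (by decide)
          (by decide) h hp
      by_cases k1 : 1 ≤ n 0
      · refine ⟨3, 0, by decide, fun i hi hi' => ?_⟩
        have hz : n 1 = 0 ∧ n 2 = 0 := by omega
        rcases hcases i with rfl | rfl | rfl | rfl <;>
          first | exact absurd rfl hi | exact absurd rfl hi' | exact hz.1 | exact hz.2
      by_cases k2 : 1 ≤ n 1
      · refine ⟨3, 1, by decide, fun i hi hi' => ?_⟩
        have hz : n 0 = 0 ∧ n 2 = 0 := by omega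
        rcases hcases i with rfl | rfl | rfl | rfl <;>
          first | exact absurd rfl hi | exact absurd rfl hi' | exact hz.1 | exact hz.2
      refine ⟨3, 2, by decide, fun i hi hi' => ?_⟩
      have hz : n 0 = 0 ∧ n 1 = 0 := by omega
      rcases hcases i with rfl | rfl | rfl | rfl <;>
          first | exact absurd rfl hi | exact absurd rfl hi' | exact hz.1 | exact hz.2
  · left
    push Not at hbig
    have b0 := hbig 0; have b1 := hbig 1; have b2 := hbig 2; have b3 := hbig 3
    intro i
    rcases hcases i with rfl | rfl | rfl | rfl <;> omega

end Summit.ValiantsHypothesis.ValiantsHypothesis.Theorems.SymPencilBoxFourProfile
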